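import Literature.Probability.FitznerVanDerHofstad2017.SrwTaylorRemainderSqrt
import Literature.Probability.FitznerVanDerHofstad2017.SrwReturnMomentBound
import HarnessLib

/-!
# The scaled large-`d` enclosure of the SRW inputs: explicit `d^{-M/2}` remainder

CITATION HEADER. This module is part of a certified REPRODUCTION of:
  R. Fitzner, R. van der Hofstad, *Generalized approach to the non-backtracking lace expansion*,
  PTRF **169** (2017) 1041–1119 [NoBLE17], §5 ((5.1) p. 1090: the SRW inputs `I_{n,l}(x)`) and
  §2.5 p. 1062 (monotonicity in `d`), as consumed by [FvdH17] EJP 22 (2017) no. 43, Thm 1.1.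

It joins `abs_srwI_sub_taylor_le_sqrt` (Taylor form + Cauchy–Schwarz + monotonicity in `d`,
`SrwTaylorRemainderSqrt.lean`) with the Gaussian domination bound `srwLaw_two_mul_zero_le`
(`p_{2M}(0;d) ≤ (2M-1)‼/(2d)^M`, `SrwReturnMomentBound.lean`):

* **`abs_srwI_sub_taylor_le_scaled`** — for `4(n+1)+1 ≤ D₀ ≤ d` and `M = l+R+1` even,
  `|I^{(d)}_{n+1,l}(x) - Σ_{i ≤ R} C(i+n,n) p^{(d)}_{l+i}(x)|
     ≤ Σ_{t ≤ n} C(R+t,t) · √((2M-1)‼ / (2d)^M) · √(I^{(D₀)}_{2(n+1-t),0}(0))`.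
  Every quantity on the right is explicit except the anchors `I^{(D₀)}_{2j,0}(0)` (`j ≤ n+1 ≤ 4`),
  certified once at `d = D₀`; the bound decays like `d^{-M/2}` uniformly in `d ≥ D₀`, so ONE
  evaluation in the variable `u = 1/d` over a box `[D, D']` (`D' = ∞` allowed) encloses every SRW
  input `I_{n,l}(x; d)`, `d ∈ [D, D']`, by its Taylor polynomial (exact walk counts) `± C u^{M/2}`.

No hypothesis of any theorem here is a programme-internal claim.

## References
* [NoBLE17] R. Fitzner, R. van der Hofstad, PTRF 169 (2017) 1041–1119: (5.1) p. 1090; §2.5 p. 1062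
  (bib key `FitznerVanDerHofstad2016NoBLE`).
* [FvdH17] R. Fitzner, R. van der Hofstad, EJP 22 (2017) no. 43, Thm 1.1.
-/

noncomputable section

open MeasureTheory Real Finset Filter Topology
open scoped BigOperators Nat

namespace Literature.Probability.FitznerVanDerHofstad2017

open Literature.Barriers.CriticalPhenomena
open Literature.Barriers.CriticalPhenomena.Slade2006Prop53 (P μI)
open Literature.Barriers.CriticalPhenomena.LongRangePhi4 (srwLaw srwLaw_nonneg)

variable {d : ℕ}

/-- **Scaled large-`d` enclosure of the SRW inputs.** For `4(n+1)+1 ≤ D₀ ≤ d` and `M = l+R+1`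
even, `|I^{(d)}_{n+1,l}(x) - Σ_{i ≤ R} C(i+n,n) p^{(d)}_{l+i}(x)| ≤
Σ_{t ≤ n} C(R+t,t) √((2M-1)‼/(2d)^M) √(I^{(D₀)}_{2(n+1-t),0}(0))` — the Taylor remainder of
[NoBLE17] (5.1) bounded EXPLICITLY and uniformly in `d`, with decay `d^{-M/2}`
(Cauchy–Schwarz on the torus, Gaussian domination of `p_{2M}(0;d)`, monotonicity of `I_{2j,0}(0)`
in `d`). [cite: FitznerVanDerHofstad2016NoBLE, (5.1) p. 1090 and §2.5 p. 1062] -/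
theorem abs_srwI_sub_taylor_le_scaled {D₀ d n l R : ℕ} (hD : 4 * (n + 1) + 1 ≤ D₀) (hd : D₀ ≤ d)
    (he : Even (l + R + 1)) (x : Fin d → ℤ) :
    |srwI d (n + 1) l x - ∑ i ∈ range (R + 1), (((i + n).choose n : ℕ) : ℝ) * srwLaw d (l + i) x|
      ≤ ∑ t ∈ range (n + 1), (((R + t).choose t : ℕ) : ℝ) *
          (Real.sqrt ((((2 * (l + R + 1) - 1)‼ : ℕ) : ℝ) / (2 * (d : ℝ)) ^ (l + R + 1)) *
            Real.sqrt (srwI D₀ (2 * (n + 1 - t)) 0 0)) := by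
  have hp : Real.sqrt (srwLaw d (2 * (l + R + 1)) 0) ≤
      Real.sqrt ((((2 * (l + R + 1) - 1)‼ : ℕ) : ℝ) / (2 * (d : ℝ)) ^ (l + R + 1)) :=
    Real.sqrt_le_sqrt (srwLaw_two_mul_zero_le (d := d) (by omega) (l + R + 1))
  refine (abs_srwI_sub_taylor_le_sqrt hD hd he x).trans (sum_le_sum fun t _ => ?_)
  refine mul_le_mul_of_nonneg_left ?_ (Nat.cast_nonneg _)
  exact mul_le_mul_of_nonneg_right hp (Real.sqrt_nonneg _)

/-- Convenience form with numeric anchor bounds `A j ≥ I^{(D₀)}_{2j,0}(0)` (`1 ≤ j ≤ n+1`):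
`|I^{(d)}_{n+1,l}(x) - Σ_{i ≤ R} C(i+n,n) p^{(d)}_{l+i}(x)| ≤
(Σ_{t ≤ n} C(R+t,t) √((2M-1)‼) √(A(n+1-t))) · (√((2d)^M))⁻¹` is NOT restated here; users take
`abs_srwI_sub_taylor_le_scaled` and bound `√(I^{(D₀)}) ≤ √A` by `Real.sqrt_le_sqrt`. This lemma
records the monotonicity step for a single anchor. [folklore] -/
theorem sqrt_srwI_anchor_le {D₀ j : ℕ} {A : ℝ} (hA : srwI D₀ (2 * j) 0 0 ≤ A) :
    Real.sqrt (srwI D₀ (2 * j) 0 0) ≤ Real.sqrt A :=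
  Real.sqrt_le_sqrt hA

end Literature.Probability.FitznerVanDerHofstad2017

end
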